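import Literature.AlgebraicTopology.CharacteristicClasses.ProjectiveSpaceLerayHirsch
import Literature.AlgebraicTopology.SingularHomology.CompactGroupExteriorCohomology
import Literature.AlgebraicTopology.SingularHomology.IntegralClassRingChange
import Literature.AlgebraicGeometry.HodgeTheory.RationalClassesRingChange
import Literature.AlgebraicGeometry.HodgeTheory.HyperplaneClassRational
import Literature.AlgebraicGeometry.Motives.ProjectiveSpaceComplexPointsOrientation
import Literature.AlgebraicGeometry.Motives.SegreEmbeddingPoints
import Literature.AlgebraicGeometry.Motives.AlgPointsProductProofs
import Literature.AlgebraicGeometry.Motives.AbelianVarietyProduct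
import Literature.AlgebraicGeometry.Motives.AbelianVarietyProofs
import HarnessLib

/-!
# Crux `WeilSixfoldsSqrtMinus7` (stmt-HodgeConjecture-1260), line `hyperbolic-eightfold-descent` — sub-goal `stub_hyperplaneCalculus` of Stub 7 (aimed partner at `d = 7`)

**The hyperplane-class calculus on `complexBetti`**: ONE compatible family of rational classes
`g_N ∈ H²(ℙᴺ_ℂ(ℂ); ℂ)` (in print `c₁(𝒪_{ℙᴺ}(1))`, up to a universal sign) with: `g_N` rational and `≠ 0` for
`N ≥ 1`; `1 ≤ e.n` for every projective embedding `e` of a positive-dimensional abelian variety; **Segre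
additivity** `e^* g = pr₁^* e_X^* g + pr₂^* e_Y^* g` for the Segre embedding `e = σ ∘ (e_X × e_Y)` of a product
(Hartshorne II Ex. 5.11: `σ^* 𝒪(1) = 𝒪(1) ⊠ 𝒪(1)`); **weight-`m` re-embeddings** `e^* g = m • e_X^* g`.

Construction: `g_N = ι(ψ_N^* x_N)`, `x_N = e(γ¹(ℂᴺ⁺¹)) ∈ H²(ℙ(ℂᴺ⁺¹); ℚ)` the Euler class of the tautological line
bundle (`tautEuler`, Husemoller Ch. 17), `ψ_N : ℙᴺ_ℂ(ℂ) ≃ₜ ℙ(ℂᴺ⁺¹)` the inverse of Serre's comparison `projPoint`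
(GAGA §2 n°5), `ι : H²(–; ℚ) → H²(–; ℂ)` the change of coefficients. Proof: (i) topological Segre additivity
`s^* x_n = pr₁^* x_a + pr₂^* x_b` for any continuous `s` with `s([z],[w]) = [z ⊗ w]` (`map_segre_tautEuler`): by
Leray–Hirsch for `U × ℙ(V)` (`projectiveSpace_lerayHirsch`, Husemoller Thm. 2.5) every class of `H²` is
`pr₁^* a₀ + r • pr₂^* x_b` (`H⁰(ℙ(ℂᵃ⁺¹)) = ℚ·1`, path connected); the coefficients are read off on the slices
`ℙ(ℂᵃ⁺¹) × [w₀]`, `[z₀] × ℙ(ℂᵇ⁺¹)`, where `s` is a projectivised linear injection (`tautEuler_map`, Husemoller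
Prop. 3.3); (ii) on complex points the Segre embedding IS `[z ⊗ w]` (`ProjectiveSpace.map_segreEmbedding_lift_pointOfVec`,
Hartshorne I Ex. 2.14), transported along `(ℙᵃ ⊗ ℙᵇ)(ℂ) ≃ₜ ℙᵃ(ℂ) × ℙᵇ(ℂ)` (Conrad Prop. 2.1) and `ψ`, then pushed to
`ℂ` by naturality of `ι`; (iii) `g_N ≠ 0`: `ι` injective, and `x_N = 0` would force `H²(ℙ(ℂᴺ⁺¹); ℚ) = 0` (Gysin
surjectivity `⌣x : H⁰ ↠ H²`, Milnor–Stasheff 12.2), killing the rational classes spanning the line `H²(ℙᴺ(ℂ); ℂ)`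
(Hatcher 3.19); (iv) `dim X ≤ N` for `X ↪ ℙᴺ`; (v) `(e_X ⊗ e_Y) ≫ fst = fst ≫ e_X`; (vi) induction with the diagonal
`Δ : X ↪ X × X` (closed, `X` separated), `Δ^*(pr₁^* u + pr₂^* v) = u + v`. The family is kept abstract through
(`ψ`, `G`, `g` with their defining equations as section hypotheses) and instantiated in the final theorem.
Theorems only; no definitions, no named facts; nothing unproved is used ((i) is also filed as
`Literature/AlgebraicTopology/CharacteristicClasses/SegreEulerClass.lean`). References: [Hartshorne1977] I Ex. 2.14,
II Ex. 4.9, 5.11; [HusemollerFibreBundles1994] Ch. 17 Thm. 2.5, Prop. 3.3; [MilnorStasheff1974] Thm. 12.2, §14;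
[SerreGAGA1956] §2 n°5; [HatcherAT2002] Thm. 3.19; [ConradAdelicPoints2012] Prop. 2.1; [vanGeemen1994HodgeAV] 5.2–5.4.
-/

noncomputable section

-- single-problem summit (Problem = Summit): the mandated namespace repeats `HodgeConjecture`.
set_option linter.dupNamespace false

open CategoryTheory
open Literature.AlgebraicGeometry Literature.AlgebraicGeometry.Motives
  Literature.AlgebraicGeometry.HodgeTheory Literature.AlgebraicTopology.SingularHomology
  Literature.Geometry.Kaehler
open AlgebraicGeometry Limits MonoidalCategory CartesianMonoidalCategory Function
open Literature.AlgebraicTopology.CharacteristicClasses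
open Literature.NumberTheory.Transcendental (projPoint isHomeomorph_projPoint projPoint_mk)
open scoped LinearAlgebra.Projectivization

namespace Summit.HodgeConjecture.HodgeConjecture.Theorems.WeilSixfoldsSqrtMinus7.HyperbolicEightfoldDescent


/-- **Leray–Hirsch in degree two**: every class of `H²(ℙ(ℂᵃ⁺¹) × ℙ(ℂᵇ⁺¹); ℚ)` is
`pr₁^* a₀ + pr₁^* a₁ ⌣ pr₂^* x_b` (`projectiveSpace_lerayHirsch`, surjectivity in degree `2`: only the
classes `1`, `x` contribute). [cite: HusemollerFibreBundles1994, Ch. 17 §2 Thm. 2.5] -/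
private theorem exists_eq_lerayHirsch_two {a b : ℕ} (c : singularCohomology ℚ ℚ (ℙ ℂ (Fin (a + 1) → ℂ) × ℙ ℂ (Fin (b + 1) → ℂ)) 2) :
    ∃ (a₀ : singularCohomology ℚ ℚ (ℙ ℂ (Fin (a + 1) → ℂ)) 2) (a₁ : singularCohomology ℚ ℚ (ℙ ℂ (Fin (a + 1) → ℂ)) 0),
      c = singularCohomology.map ℚ ℚ (ContinuousMap.fst : C(ℙ ℂ (Fin (a + 1) → ℂ) × ℙ ℂ (Fin (b + 1) → ℂ), ℙ ℂ (Fin (a + 1) → ℂ))) 2 a₀ +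
        cupProduct (show 0 + 2 = 2 from rfl) (singularCohomology.map ℚ ℚ (ContinuousMap.fst : C(ℙ ℂ (Fin (a + 1) → ℂ) × ℙ ℂ (Fin (b + 1) → ℂ), ℙ ℂ (Fin (a + 1) → ℂ))) 0 a₁)
          (singularCohomology.map ℚ ℚ (ContinuousMap.snd : C(ℙ ℂ (Fin (a + 1) → ℂ) × ℙ ℂ (Fin (b + 1) → ℂ), ℙ ℂ (Fin (b + 1) → ℂ))) 2 (tautEuler (Fin (b + 1) → ℂ) ℚ 1)) := by
  obtain ⟨A, hA⟩ := (projectiveSpace_lerayHirsch ℚ b (Fin (b + 1) → ℂ) (Module.finrank_fin_fun ℂ) (ℙ ℂ (Fin (a + 1) → ℂ)) 2).2 c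
  rw [LerayHirsch.lhMap_apply] at hA
  have hT0 : ∀ (h0 : LerayHirsch.evenDeg (b + 1) 0 ≤ 2), cupProduct (Nat.sub_add_cancel h0)
      (singularCohomology.map ℚ ℚ (ContinuousMap.fst : C(ℙ ℂ (Fin (a + 1) → ℂ) × ℙ ℂ (Fin (b + 1) → ℂ), ℙ ℂ (Fin (a + 1) → ℂ))) (2 - LerayHirsch.evenDeg (b + 1) 0)
        (A ⟨0, h0⟩)) (projCls ℚ (Fin (b + 1) → ℂ) (ℙ ℂ (Fin (a + 1) → ℂ)) (b + 1) 0) =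
      singularCohomology.map ℚ ℚ (ContinuousMap.fst : C(ℙ ℂ (Fin (a + 1) → ℂ) × ℙ ℂ (Fin (b + 1) → ℂ), ℙ ℂ (Fin (a + 1) → ℂ))) 2 (A ⟨0, h0⟩) := by
    intro h0
    change cupProduct (show 2 + 0 = 2 from rfl) (singularCohomology.map ℚ ℚ (ContinuousMap.fst : C(ℙ ℂ (Fin (a + 1) → ℂ) × ℙ ℂ (Fin (b + 1) → ℂ), ℙ ℂ (Fin (a + 1) → ℂ))) 2 (A ⟨0, h0⟩))
      (singularCohomology.map ℚ ℚ (ContinuousMap.snd : C(ℙ ℂ (Fin (a + 1) → ℂ) × ℙ ℂ (Fin (b + 1) → ℂ), ℙ ℂ (Fin (b + 1) → ℂ))) 0 (singularCohomology.one ℚ (ℙ ℂ (Fin (b + 1) → ℂ)))) = _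
    rw [singularCohomology.map_one]
    exact cupProduct_one' ℚ _ _
  cases b with
  | zero =>
    have h0 : LerayHirsch.evenDeg 1 0 ≤ 2 := Nat.zero_le _
    refine ⟨A ⟨0, h0⟩, 0, ?_⟩
    rw [Fintype.sum_eq_single (0 : Fin 1) (fun j hj => absurd (Subsingleton.elim j 0) hj), dif_pos h0, hT0 h0] at hA
    have hz : singularCohomology.map ℚ ℚ (ContinuousMap.fst : C(ℙ ℂ (Fin (a + 1) → ℂ) × ℙ ℂ (Fin (0 + 1) → ℂ), ℙ ℂ (Fin (a + 1) → ℂ))) 0 (0 : singularCohomology ℚ ℚ (ℙ ℂ (Fin (a + 1) → ℂ)) 0) = 0 :=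
      map_zero _
    rw [hz, LinearMap.map_zero₂, add_zero]
    exact hA.symm
  | succ b =>
    have h0 : LerayHirsch.evenDeg (b + 2) 0 ≤ 2 := Nat.zero_le _
    have h1 : LerayHirsch.evenDeg (b + 2) 1 ≤ 2 := by change 2 * 1 ≤ 2; omega
    refine ⟨A ⟨0, h0⟩, A ⟨1, h1⟩, ?_⟩
    have hT1 : cupProduct (Nat.sub_add_cancel h1)
        (singularCohomology.map ℚ ℚ (ContinuousMap.fst : C(ℙ ℂ (Fin (a + 1) → ℂ) × ℙ ℂ (Fin (b + 2) → ℂ), ℙ ℂ (Fin (a + 1) → ℂ))) (2 - LerayHirsch.evenDeg (b + 2) 1)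
          (A ⟨1, h1⟩)) (projCls ℚ (Fin (b + 2) → ℂ) (ℙ ℂ (Fin (a + 1) → ℂ)) (b + 2) 1) =
        cupProduct (show 0 + 2 = 2 from rfl) (singularCohomology.map ℚ ℚ (ContinuousMap.fst : C(ℙ ℂ (Fin (a + 1) → ℂ) × ℙ ℂ (Fin (b + 2) → ℂ), ℙ ℂ (Fin (a + 1) → ℂ))) 0 (A ⟨1, h1⟩))
          (singularCohomology.map ℚ ℚ (ContinuousMap.snd : C(ℙ ℂ (Fin (a + 1) → ℂ) × ℙ ℂ (Fin (b + 2) → ℂ), ℙ ℂ (Fin (b + 2) → ℂ))) 2 (tautEuler (Fin (b + 2) → ℂ) ℚ 1)) := by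
      change cupProduct (show 0 + 2 = 2 from rfl) (singularCohomology.map ℚ ℚ (ContinuousMap.fst : C(ℙ ℂ (Fin (a + 1) → ℂ) × ℙ ℂ (Fin (b + 2) → ℂ), ℙ ℂ (Fin (a + 1) → ℂ))) 0 (A ⟨1, h1⟩))
        (singularCohomology.map ℚ ℚ (ContinuousMap.snd : C(ℙ ℂ (Fin (a + 1) → ℂ) × ℙ ℂ (Fin (b + 2) → ℂ), ℙ ℂ (Fin (b + 2) → ℂ))) 2
          (cupProduct (show 0 + 2 = 2 from rfl) (singularCohomology.one ℚ (ℙ ℂ (Fin (b + 2) → ℂ))) (tautEuler (Fin (b + 2) → ℂ) ℚ 1))) = _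
      rw [one_cupProduct']
    rw [Fintype.sum_eq_add (0 : Fin (b + 2)) (1 : Fin (b + 2)) (by simp) (fun j hj => ?_), dif_pos h0, dif_pos h1,
      hT0 h0, hT1] at hA
    · exact hA.symm
    · obtain ⟨j, hj'⟩ := j
      have : j ≠ 0 := fun h => hj.1 (Fin.ext h)
      have : j ≠ 1 := fun h => hj.2 (Fin.ext h)
      exact dif_neg (by change ¬ (2 * j ≤ 2); omega)

/-- **The Segre map pulls `x_n` back to `pr₁^* x_a + pr₂^* x_b`**: for a continuous `s` with
`s([z], [w]) = [z ⊗ w]` (coordinates enumerated by `e`), `s^* x_n = pr₁^* x_a + pr₂^* x_b` (Hartshorne II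
Ex. 5.11, `σ^* 𝒪(1) = 𝒪(1) ⊠ 𝒪(1)`, on Euler classes; slice argument: Leray–Hirsch, then restriction to
`ℙ(ℂᵃ⁺¹) × [w₀]`, `[z₀] × ℙ(ℂᵇ⁺¹)`, where `s` is a projectivised linear injection). [cite: Hartshorne1977, II Ex. 5.11] -/
private theorem map_segre_tautEuler {a b n : ℕ} (e : Fin (a + 1) × Fin (b + 1) ≃ Fin (n + 1))
    (s : C(ℙ ℂ (Fin (a + 1) → ℂ) × ℙ ℂ (Fin (b + 1) → ℂ), ℙ ℂ (Fin (n + 1) → ℂ))) (hs : ∀ (z : Fin (a + 1) → ℂ) (hz : z ≠ 0) (w : Fin (b + 1) → ℂ) (hw : w ≠ 0)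
      (hzw : (fun t => z (e.symm t).1 * w (e.symm t).2) ≠ 0),
      s (Projectivization.mk ℂ z hz, Projectivization.mk ℂ w hw) = Projectivization.mk ℂ _ hzw) :
    singularCohomology.map ℚ ℚ s 2 (tautEuler (Fin (n + 1) → ℂ) ℚ 1) =
      singularCohomology.map ℚ ℚ (ContinuousMap.fst : C(ℙ ℂ (Fin (a + 1) → ℂ) × ℙ ℂ (Fin (b + 1) → ℂ), ℙ ℂ (Fin (a + 1) → ℂ))) 2 (tautEuler (Fin (a + 1) → ℂ) ℚ 1) +
        singularCohomology.map ℚ ℚ (ContinuousMap.snd : C(ℙ ℂ (Fin (a + 1) → ℂ) × ℙ ℂ (Fin (b + 1) → ℂ), ℙ ℂ (Fin (b + 1) → ℂ))) 2 (tautEuler (Fin (b + 1) → ℂ) ℚ 1) := by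
  have hne : ∀ {z : Fin (a + 1) → ℂ} {w : Fin (b + 1) → ℂ}, z ≠ 0 → w ≠ 0 →
      (fun t => z (e.symm t).1 * w (e.symm t).2) ≠ 0 := fun {z w} hz hw => by
    obtain ⟨⟨i, hi⟩, ⟨j, hj⟩⟩ := And.intro (Function.ne_iff.mp hz) (Function.ne_iff.mp hw)
    exact Function.ne_iff.mpr ⟨e (i, j), by simpa using mul_ne_zero hi hj⟩
  have h1a : (fun _ => 1 : Fin (a + 1) → ℂ) ≠ 0 := fun h => one_ne_zero (congr_fun h 0)
  have h1b : (fun _ => 1 : Fin (b + 1) → ℂ) ≠ 0 := fun h => one_ne_zero (congr_fun h 0)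
  set p₀ : ℙ ℂ (Fin (a + 1) → ℂ) := Projectivization.mk ℂ _ h1a
  set q₀ : ℙ ℂ (Fin (b + 1) → ℂ) := Projectivization.mk ℂ _ h1b
  -- the linear injections `z ↦ z ⊗ 1`, `w ↦ 1 ⊗ w`
  let LA : (Fin (a + 1) → ℂ) →ₗ[ℂ] (Fin (n + 1) → ℂ) :=
    { toFun := fun z t => z (e.symm t).1 * (fun _ => 1 : Fin (b + 1) → ℂ) (e.symm t).2
      map_add' := fun z z' => funext fun t => by simp
      map_smul' := fun c z => funext fun t => by simp }
  let LB : (Fin (b + 1) → ℂ) →ₗ[ℂ] (Fin (n + 1) → ℂ) :=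
    { toFun := fun w t => (fun _ => 1 : Fin (a + 1) → ℂ) (e.symm t).1 * w (e.symm t).2
      map_add' := fun w w' => funext fun t => by simp [mul_add]
      map_smul' := fun c w => funext fun t => by simp [mul_left_comm] }
  have hLA : Injective LA := (injective_iff_map_eq_zero _).2 fun z hz => funext fun i => by
    simpa [LA] using congr_fun hz (e (i, 0))
  have hLB : Injective LB := (injective_iff_map_eq_zero _).2 fun w hw => funext fun j => by
    simpa [LB] using congr_fun hw (e (0, j))
  -- the slices
  set jL : C(ℙ ℂ (Fin (a + 1) → ℂ), ℙ ℂ (Fin (a + 1) → ℂ) × ℙ ℂ (Fin (b + 1) → ℂ)) := ContinuousMap.prodMk (ContinuousMap.id _) (ContinuousMap.const _ q₀)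
  set jR : C(ℙ ℂ (Fin (b + 1) → ℂ), ℙ ℂ (Fin (a + 1) → ℂ) × ℙ ℂ (Fin (b + 1) → ℂ)) := ContinuousMap.prodMk (ContinuousMap.const _ p₀) (ContinuousMap.id _)
  have hsL : s.comp jL = projMapC LA hLA := by
    ext p
    induction p using Projectivization.ind with
    | h z hz => rw [ContinuousMap.comp_apply, projMapC_apply, Projectivization.map_mk]; exact hs z hz _ h1b (hne hz h1b)
  have hsR : s.comp jR = projMapC LB hLB := by
    ext q
    induction q using Projectivization.ind with
    | h w hw => rw [ContinuousMap.comp_apply, projMapC_apply, Projectivization.map_mk]; exact hs _ h1a w hw (hne h1a hw)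
  have hfstL : (ContinuousMap.fst : C(ℙ ℂ (Fin (a + 1) → ℂ) × ℙ ℂ (Fin (b + 1) → ℂ), ℙ ℂ (Fin (a + 1) → ℂ))).comp jL = ContinuousMap.id _ := by ext; rfl
  have hsndL : (ContinuousMap.snd : C(ℙ ℂ (Fin (a + 1) → ℂ) × ℙ ℂ (Fin (b + 1) → ℂ), ℙ ℂ (Fin (b + 1) → ℂ))).comp jL = ContinuousMap.const _ q₀ := by ext; rfl
  have hfstR : (ContinuousMap.fst : C(ℙ ℂ (Fin (a + 1) → ℂ) × ℙ ℂ (Fin (b + 1) → ℂ), ℙ ℂ (Fin (a + 1) → ℂ))).comp jR = ContinuousMap.const _ p₀ := by ext; rfl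
  have hsndR : (ContinuousMap.snd : C(ℙ ℂ (Fin (a + 1) → ℂ) × ℙ ℂ (Fin (b + 1) → ℂ), ℙ ℂ (Fin (b + 1) → ℂ))).comp jR = ContinuousMap.id _ := by ext; rfl
  -- Leray–Hirsch decomposition of `s^* x_n`, with `a₁ = r • 1` (`ℙ ℂ (Fin (a + 1) → ℂ)` is path connected)
  obtain ⟨a₀, a₁, hc⟩ := exists_eq_lerayHirsch_two (singularCohomology.map ℚ ℚ s 2 (tautEuler (Fin (n + 1) → ℂ) ℚ 1))
  haveI : PathConnectedSpace (ℙ ℂ (Fin (a + 1) → ℂ)) := by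
    have h1 : 1 < Module.rank ℝ (Fin (a + 1) → ℂ) := by
      apply Module.one_lt_rank_of_one_lt_finrank
      rw [Module.finrank_pi_fintype, Finset.sum_const, Finset.card_univ, Fintype.card_fin, Complex.finrank_real_complex,
        smul_eq_mul]
      omega
    haveI : PathConnectedSpace {v : Fin (a + 1) → ℂ // v ≠ 0} :=
      isPathConnected_iff_pathConnectedSpace.1 (isPathConnected_compl_singleton_of_one_lt_rank h1 0)
    exact (Projectivization.isQuotientMap_mk (𝕜 := ℂ) (W := Fin (a + 1) → ℂ)).surjective.pathConnectedSpace
      Projectivization.continuous_mk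
  set r : ℚ := singularCohomologyZeroEquiv ℚ ℚ (ℙ ℂ (Fin (a + 1) → ℂ)) a₁
  have hc' : singularCohomology.map ℚ ℚ s 2 (tautEuler (Fin (n + 1) → ℂ) ℚ 1) = singularCohomology.map ℚ ℚ (ContinuousMap.fst : C(ℙ ℂ (Fin (a + 1) → ℂ) × ℙ ℂ (Fin (b + 1) → ℂ), ℙ ℂ (Fin (a + 1) → ℂ))) 2 a₀ +
      r • singularCohomology.map ℚ ℚ (ContinuousMap.snd : C(ℙ ℂ (Fin (a + 1) → ℂ) × ℙ ℂ (Fin (b + 1) → ℂ), ℙ ℂ (Fin (b + 1) → ℂ))) 2 (tautEuler (Fin (b + 1) → ℂ) ℚ 1) := by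
    rw [hc, singularCohomology.eq_smul_one ℚ a₁, map_smul, singularCohomology.map_one, smul_cupProduct, one_cupProduct']
  have key1 : a₀ = tautEuler (Fin (a + 1) → ℂ) ℚ 1 := by
    have h := congr_arg (singularCohomology.map ℚ ℚ jL 2) hc'
    rw [map_add, map_smul, singularCohomology.map_map, singularCohomology.map_map, singularCohomology.map_map, hsL,
      hfstL, hsndL, ← tautEuler_map, singularCohomology.map_id,
      singularCohomology.map_const_of_ne_zero ℚ q₀ two_ne_zero, smul_zero, add_zero] at h
    exact h.symm
  have key2 : r • tautEuler (Fin (b + 1) → ℂ) ℚ 1 = tautEuler (Fin (b + 1) → ℂ) ℚ 1 := by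
    have h := congr_arg (singularCohomology.map ℚ ℚ jR 2) hc'
    rw [map_add, map_smul, singularCohomology.map_map, singularCohomology.map_map, singularCohomology.map_map, hsR,
      hfstR, hsndR, ← tautEuler_map, singularCohomology.map_id,
      singularCohomology.map_const_of_ne_zero ℚ p₀ two_ne_zero, zero_add] at h
    exact h.symm
  rw [hc', key1, ← map_smul, key2]

/-- Serre's point `[z] ∈ ℙᴺ_ℂ(ℂ)` (`AnalytificationProjProofs`) is the point with homogeneous coordinates `z` of
`ProjectiveSpaceFieldPoints` (same basic opens `D₊(G)`; a complex point of `ℙᴺ_ℂ` is determined by its underlying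
point). [cite: SerreGAGA1956, §2 n°5 Prop. 2] -/
private theorem pointOfVec_eq (N : ℕ) (z : Fin (N + 1) → ℂ) (hz : z ≠ 0) :
    Literature.NumberTheory.Transcendental.pointOfVec N z hz = ProjectiveSpace.pointOfVec ℂ z hz := by
  letI := MvPolynomial.gradedAlgebra (σ := Fin (N + 1)) (R := ℂ)
  haveI : LocallyOfFiniteType (projectiveSpace N ℂ).hom :=
    locallyOfFiniteType_of_isSmoothProjective (isSmoothProjective_projectiveSpace' N)
  refine ComplexPoints.ext_of_pt_eq
    (Literature.NumberTheory.Transcendental.Proj.ext_of_forall_mem_basicOpen_iff _ fun m hm G hG => ?_)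
  exact (Literature.NumberTheory.Transcendental.pt_pointOfVec_mem_basicOpen_iff N z hz hm hG).trans
    (ProjectiveSpace.pt_pointOfVec_mem_basicOpen_iff z hz hm hG).symm

section Family

variable {ψ : ∀ N : ℕ, ComplexPoints (projectiveSpace N ℂ) ≃ₜ ℙ ℂ (Fin (N + 1) → ℂ)}
  (hψ : ∀ (N : ℕ) (z : Fin (N + 1) → ℂ) (hz : z ≠ 0),
    (ψ N).symm (Projectivization.mk ℂ z hz) = ProjectiveSpace.pointOfVec ℂ z hz)
  {G : ∀ N : ℕ, singularCohomology ℚ ℚ (ComplexPoints (projectiveSpace N ℂ)) 2}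
  (hG : ∀ N, G N = singularCohomology.map ℚ ℚ (ψ N : C(ComplexPoints (projectiveSpace N ℂ), ℙ ℂ (Fin (N + 1) → ℂ))) 2
    (tautEuler (Fin (N + 1) → ℂ) ℚ 1))
  {g : ∀ N : ℕ, complexBetti (projectiveSpace N ℂ) 2}
  (hg : ∀ N, g N = singularCohomology.ringChange (algebraMap ℚ ℂ) (ComplexPoints (projectiveSpace N ℂ)) 2 (G N))

include hψ hG in
/-- **Segre additivity over `ℚ`**: `σ^* G_{ab+a+b} = fst^* G_a + snd^* G_b` on `H²((ℙᵃ ⊗ ℙᵇ)(ℂ); ℚ)` —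
`map_segre_tautEuler` transported along `(ℙᵃ ⊗ ℙᵇ)(ℂ) ≃ₜ ℙ(ℂᵃ⁺¹) × ℙ(ℂᵇ⁺¹)`, the Segre embedding being
`([z], [w]) ↦ [z ⊗ w]` on complex points. [cite: Hartshorne1977, I Ex. 2.14 and II Ex. 5.11] -/
private theorem map_segre_G (a b : ℕ) :
    singularCohomology.map ℚ ℚ (AlgPoints.mapContinuous (L := ℂ) (segreEmbedding a b ℂ)) 2 (G (a * b + a + b)) =
      singularCohomology.map ℚ ℚ (AlgPoints.mapContinuous (L := ℂ) (fst (projectiveSpace a ℂ) (projectiveSpace b ℂ))) 2 (G a) +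
        singularCohomology.map ℚ ℚ (AlgPoints.mapContinuous (L := ℂ) (snd (projectiveSpace a ℂ) (projectiveSpace b ℂ))) 2 (G b) := by
  set n := a * b + a + b
  set Pa := projectiveSpace a ℂ
  set Pb := projectiveSpace b ℂ
  let T : ComplexPoints (Pa ⊗ Pb) ≃ₜ ComplexPoints Pa × ComplexPoints Pb :=
    Homeomorph.mk AlgPoints.prodEquiv AlgPoints.continuous_prodEquiv AlgPoints.continuous_prodEquiv_symm
  let Ψ : ComplexPoints (Pa ⊗ Pb) ≃ₜ ℙ ℂ (Fin (a + 1) → ℂ) × ℙ ℂ (Fin (b + 1) → ℂ) := T.trans ((ψ a).prodCongr (ψ b))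
  let σ : C(ComplexPoints (Pa ⊗ Pb), ComplexPoints (projectiveSpace n ℂ)) := AlgPoints.mapContinuous (L := ℂ) (segreEmbedding a b ℂ)
  let s : C(ℙ ℂ (Fin (a + 1) → ℂ) × ℙ ℂ (Fin (b + 1) → ℂ), ℙ ℂ (Fin (n + 1) → ℂ)) :=
    (ψ n : C(_, _)).comp (σ.comp (Ψ.symm : C(_, _)))
  have hs : ∀ (z : Fin (a + 1) → ℂ) (hz : z ≠ 0) (w : Fin (b + 1) → ℂ) (hw : w ≠ 0)
      (hzw : (fun t => z ((segreIndexEquiv a b).symm t).1 * w ((segreIndexEquiv a b).symm t).2) ≠ 0),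
      s (Projectivization.mk ℂ z hz, Projectivization.mk ℂ w hw) = Projectivization.mk ℂ _ hzw := by
    intro z hz w hw hzw
    change ψ n (AlgPoints.map (segreEmbedding a b ℂ)
      (lift ((ψ a).symm (Projectivization.mk ℂ z hz)) ((ψ b).symm (Projectivization.mk ℂ w hw)))) = _
    rw [hψ, hψ, ProjectiveSpace.map_segreEmbedding_lift_pointOfVec, ← hψ, Homeomorph.apply_symm_apply]
  have hcomp : (ψ n : C(_, _)).comp σ = s.comp (Ψ : C(_, _)) := by ext P; simp [s]
  have hfst : (ContinuousMap.fst : C(ℙ ℂ (Fin (a + 1) → ℂ) × ℙ ℂ (Fin (b + 1) → ℂ), _)).comp (Ψ : C(_, _)) =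
      (ψ a : C(_, _)).comp (AlgPoints.mapContinuous (L := ℂ) (fst Pa Pb)) := by ext P; rfl
  have hsnd : (ContinuousMap.snd : C(ℙ ℂ (Fin (a + 1) → ℂ) × ℙ ℂ (Fin (b + 1) → ℂ), _)).comp (Ψ : C(_, _)) =
      (ψ b : C(_, _)).comp (AlgPoints.mapContinuous (L := ℂ) (snd Pa Pb)) := by ext P; rfl
  calc singularCohomology.map ℚ ℚ σ 2 (G n)
      = singularCohomology.map ℚ ℚ (Ψ : C(_, _)) 2 (singularCohomology.map ℚ ℚ s 2 (tautEuler (Fin (n + 1) → ℂ) ℚ 1)) := by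
        rw [hG, singularCohomology.map_map, hcomp, singularCohomology.map_map]
    _ = _ := by
        rw [map_segre_tautEuler (segreIndexEquiv a b) s hs, map_add, singularCohomology.map_map,
          singularCohomology.map_map, hfst, hsnd, ← singularCohomology.map_map, ← singularCohomology.map_map, ← hG, ← hG]

include hψ hG hg in
/-- **Segre additivity on `complexBetti`**: `σ^* g_{ab+a+b} = fst^* g_a + snd^* g_b` (the `ℚ`-identity pushed along the
change of coefficients, natural in continuous maps). [cite: Hartshorne1977, II Ex. 5.11] -/
private theorem map_segre_g (a b : ℕ) :
    complexBetti.map (segreEmbedding a b ℂ) 2 (g (a * b + a + b)) =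
      complexBetti.map (fst (projectiveSpace a ℂ) (projectiveSpace b ℂ)) 2 (g a) +
        complexBetti.map (snd (projectiveSpace a ℂ) (projectiveSpace b ℂ)) 2 (g b) := by
  rw [hg, hg, hg]
  change singularCohomology.map ℂ ℂ _ 2 _ = singularCohomology.map ℂ ℂ _ 2 _ + singularCohomology.map ℂ ℂ _ 2 _
  rw [← singularCohomology.ringChange_map, ← singularCohomology.ringChange_map,
    ← singularCohomology.ringChange_map, map_segre_G hψ hG, map_add]

include hG hg in
/-- **`g_N ≠ 0` for `N ≥ 1`**: otherwise `x_N = 0` over `ℚ` (`ι` injective, `ψ_N` a homeomorphism), so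
`H²(ℙ(ℂᴺ⁺¹); ℚ) = 0` by the Gysin surjectivity `⌣x : H⁰ ↠ H²`, so every rational class of `H²(ℙᴺ(ℂ); ℂ)` vanishes,
contradicting `dim = 1`. [cite: MilnorStasheff1974, §12 Thm. 12.2 and §14 Thm. 14.4] [cite: HatcherAT2002, Thm. 3.19] -/
private theorem g_ne_zero (N : ℕ) (hN : 1 ≤ N) : g N ≠ 0 := by
  intro h0
  have h1 : G N = 0 := ringChange_rat_injective (by rw [map_zero, ← hg]; exact h0)
  have hx : tautEuler (Fin (N + 1) → ℂ) ℚ 1 = 0 := by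
    have : singularCohomology.map ℚ ℚ ((ψ N).symm : C(ℙ ℂ (Fin (N + 1) → ℂ), ComplexPoints (projectiveSpace N ℂ))) 2 (G N) =
        tautEuler (Fin (N + 1) → ℂ) ℚ 1 := by
      rw [hG, singularCohomology.map_map, Homeomorph.toContinuousMap_comp_symm, singularCohomology.map_id]; rfl
    rw [← this, h1, map_zero]
  have h2 : ∀ y : singularCohomology ℚ ℚ (ℙ ℂ (Fin (N + 1) → ℂ)) 2, y = 0 := by
    intro y
    obtain ⟨u, hu⟩ := cup_tautEuler_surjective (Fin (N + 1) → ℂ) ℚ (n := N + 1)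
      (Module.finrank_fin_fun ℂ) (by omega) (k := 0) (by omega) y
    rw [← hu]
    change cupProduct _ u (tautEuler (Fin (N + 1) → ℂ) ℚ 1) = 0
    rw [hx, LinearMap.map_zero]
  have h3 : ∀ Y : singularCohomology ℚ ℚ (ComplexPoints (projectiveSpace N ℂ)) 2, Y = 0 := by
    intro Y
    have : singularCohomology.map ℚ ℚ (ψ N : C(ComplexPoints (projectiveSpace N ℂ), ℙ ℂ (Fin (N + 1) → ℂ))) 2
        (singularCohomology.map ℚ ℚ ((ψ N).symm : C(ℙ ℂ (Fin (N + 1) → ℂ), ComplexPoints (projectiveSpace N ℂ))) 2 Y) = Y := by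
      rw [singularCohomology.map_map, Homeomorph.symm_comp_toContinuousMap, singularCohomology.map_id]; rfl
    rw [← this, h2 (singularCohomology.map ℚ ℚ _ 2 Y), map_zero]
  have hspan := span_isRationalClass_eq_top_of_isSmoothProjective_holds N (projectiveSpace N ℂ)
    (isSmoothProjective_projectiveSpace' N) 2
  have hall : ∀ c : complexBetti (projectiveSpace N ℂ) 2, c = 0 := by
    intro c
    have hc : c ∈ Submodule.span ℂ {c : complexBetti (projectiveSpace N ℂ) 2 | IsRationalClass c} := by
      rw [hspan]; trivial
    refine Submodule.span_induction (fun d hd => ?_) rfl (fun _ _ _ _ h h' => by rw [h, h', add_zero])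
      (fun t d _ h => by rw [h, smul_zero]) hc
    obtain ⟨Y, rfl⟩ := IsRationalClass.exists_ringChange_eq hd
    rw [h3 Y, map_zero]
  have hfin := finrank_complexBetti_projectiveSpace_two_mul_eq_one N (p := 1) hN
  haveI : Subsingleton (complexBetti (projectiveSpace N ℂ) (2 * 1)) := subsingleton_of_forall_eq 0 hall
  rw [Module.finrank_zero_of_subsingleton] at hfin
  exact zero_ne_one hfin

variable {X Y : SchemeOver ℂ}

include hψ hG hg in
/-- For `ι_X : X ⟶ ℙᵃ`, `ι_Y : Y ⟶ ℙᵇ`, the composite `(ι_X ⊗ ι_Y) ≫ σ` pulls `g` back to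
`fst^* ι_X^* g + snd^* ι_Y^* g` (`(ι_X ⊗ ι_Y) ≫ fst = fst ≫ ι_X`). [cite: Hartshorne1977, II Ex. 5.11] -/
private theorem map_tensorHom_segre {a b : ℕ} (ιX : X ⟶ projectiveSpace a ℂ) (ιY : Y ⟶ projectiveSpace b ℂ) :
    complexBetti.map ((ιX ⊗ₘ ιY) ≫ segreEmbedding a b ℂ) 2 (g (a * b + a + b)) =
      complexBetti.map (fst X Y) 2 (complexBetti.map ιX 2 (g a)) + complexBetti.map (snd X Y) 2 (complexBetti.map ιY 2 (g b)) := by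
  rw [complexBetti.map_comp, ModuleCat.comp_apply, map_segre_g hψ hG hg, map_add,
    ← ModuleCat.comp_apply, ← complexBetti.map_comp, tensorHom_fst, complexBetti.map_comp, ModuleCat.comp_apply]
  congr 1
  rw [← ModuleCat.comp_apply, ← complexBetti.map_comp, tensorHom_snd, complexBetti.map_comp, ModuleCat.comp_apply]

/-- `(ι_X ⊗ ι_Y) ≫ σ` is a closed immersion for closed immersions `ι_X`, `ι_Y` (stable under products and
composition; the Segre map is one). [cite: Hartshorne1977, II Ex. 4.9] -/
private theorem isClosedImmersion_tensorHom_segre {a b : ℕ} (ιX : X ⟶ projectiveSpace a ℂ)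
    (ιY : Y ⟶ projectiveSpace b ℂ) [IsClosedImmersion ιX.left] [IsClosedImmersion ιY.left] :
    IsClosedImmersion ((ιX ⊗ₘ ιY) ≫ segreEmbedding a b ℂ).left := by
  have := isClosedImmersion_tensorHom_left ιX ιY
  change IsClosedImmersion ((ιX ⊗ₘ ιY).left ≫ (segreEmbedding a b ℂ).left)
  infer_instance

/-- The diagonal `(𝟙, 𝟙) : X ⟶ X ⊗ X` of a separated `ℂ`-scheme is a closed immersion (it is Mathlib's
`pullback.diagonal` of the structure morphism). [cite: Hartshorne1977, II Cor. 4.2] -/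
private theorem isClosedImmersion_lift_id [IsSeparated X.hom] : IsClosedImmersion (lift (𝟙 X) (𝟙 X)).left := by
  have hΔ : (lift (𝟙 X) (𝟙 X)).left = pullback.diagonal X.hom := by
    apply pullback.hom_ext <;> simp [pullback.diagonal]
  rw [hΔ]
  exact IsSeparated.isClosedImmersion_diagonal

include hψ hG hg in
/-- `Δ^*` of the Segre pull-back of two embeddings `ι₁, ι₂` of the same `X` is `ι₁^* g + ι₂^* g`
(`Δ ≫ fst = 𝟙 = Δ ≫ snd`). [cite: Hartshorne1977, II Ex. 5.11] -/
private theorem map_diag_segre {a b : ℕ} (ι₁ : X ⟶ projectiveSpace a ℂ) (ι₂ : X ⟶ projectiveSpace b ℂ) :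
    complexBetti.map (lift (𝟙 X) (𝟙 X) ≫ (ι₁ ⊗ₘ ι₂) ≫ segreEmbedding a b ℂ) 2 (g (a * b + a + b)) =
      complexBetti.map ι₁ 2 (g a) + complexBetti.map ι₂ 2 (g b) := by
  rw [complexBetti.map_comp, ModuleCat.comp_apply, map_tensorHom_segre hψ hG hg, map_add,
    ← ModuleCat.comp_apply (complexBetti.map (fst X X) 2), ← complexBetti.map_comp, lift_fst,
    ← ModuleCat.comp_apply (complexBetti.map (snd X X) 2), ← complexBetti.map_comp, lift_snd, complexBetti.map_id]
  rfl

include hψ hG hg in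
/-- **Weight-`m` re-embeddings** `e^* g = m • e_X^* g` of an abelian variety, `m ≥ 1`: inductively
`e_{m+1} = σ ∘ (e_m × e_X) ∘ Δ` (`Δ` closed: `X` is separated). [cite: Hartshorne1977, II Ex. 5.11 and II Cor. 4.8] -/
private theorem exists_weight (A : AbelianVariety ℂ) (eA : ProjectiveEmbedding A.X) :
    ∀ m : ℕ, 0 < m → ∃ e : ProjectiveEmbedding A.X,
      complexBetti.map e.ι 2 (g e.n) = (m : ℂ) • complexBetti.map eA.ι 2 (g eA.n)
  | 0, h => absurd h (lt_irrefl 0)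
  | 1, _ => ⟨eA, by rw [Nat.cast_one, one_smul]⟩
  | m + 2, _ => by
    obtain ⟨e₁, he₁⟩ := exists_weight A eA (m + 1) (Nat.succ_pos m)
    haveI := isClosedImmersion_lift_id (X := A.X)
    haveI := isClosedImmersion_tensorHom_segre e₁.ι eA.ι
    refine ⟨⟨e₁.n * eA.n + e₁.n + eA.n, lift (𝟙 A.X) (𝟙 A.X) ≫ (e₁.ι ⊗ₘ eA.ι) ≫ segreEmbedding e₁.n eA.n ℂ, ?_⟩, ?_⟩
    · change IsClosedImmersion ((lift (𝟙 A.X) (𝟙 A.X)).left ≫ ((e₁.ι ⊗ₘ eA.ι) ≫ segreEmbedding e₁.n eA.n ℂ).left)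
      infer_instance
    · change complexBetti.map (lift (𝟙 A.X) (𝟙 A.X) ≫ (e₁.ι ⊗ₘ eA.ι) ≫ segreEmbedding e₁.n eA.n ℂ) 2
        (g (e₁.n * eA.n + e₁.n + eA.n)) = _
      rw [map_diag_segre hψ hG hg, he₁, Nat.cast_add, Nat.cast_add, Nat.cast_one, Nat.cast_two, add_smul, add_smul,
        one_smul, add_assoc, ← two_smul ℂ]

end Family

/-- **The hyperplane-class calculus on `complexBetti`** (sub-goal G4 of the aimed partner at `d = 7`, line
`hyperbolic-eightfold-descent` of crux `WeilSixfoldsSqrtMinus7`): a compatible family of rational, non-zero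
(`N ≥ 1`) hyperplane classes `g_N = ι(ψ_N^* e(γ¹(ℂᴺ⁺¹))) ∈ H²(ℙᴺ_ℂ(ℂ); ℂ)` (`ψ_N` the inverse of Serre's `projPoint`;
in print `c₁(𝒪_{ℙᴺ}(1))` up to the universal sign) with `1 ≤ e.n` for embeddings of positive-dimensional abelian
varieties (`dim X ≤ N`), Segre additivity `e^* g = pr₁^* e_X^* g + pr₂^* e_Y^* g` for `σ ∘ (e_X × e_Y)` (Hartshorne
II Ex. 5.11) and weight-`m` re-embeddings `e^* g = m • e_X^* g`. [cite: Hartshorne1977, II Ex. 5.11] [cite: vanGeemen1994HodgeAV, 5.2–5.4] -/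
theorem stub_hyperplaneCalculus :
    ∃ g : ∀ N : ℕ, complexBetti (projectiveSpace N ℂ) 2,
      (∀ N, IsRationalClass (g N)) ∧ (∀ N, 1 ≤ N → g N ≠ 0) ∧
      (∀ (X : AbelianVariety ℂ) (e : ProjectiveEmbedding X.X), 1 ≤ X.dim → 1 ≤ e.n) ∧
      (∀ (X Y : AbelianVariety ℂ) (eX : ProjectiveEmbedding X.X) (eY : ProjectiveEmbedding Y.X),
        ∃ e : ProjectiveEmbedding (X.prod Y).X,
          complexBetti.map e.ι 2 (g e.n) =
            complexBetti.map (AbelianVariety.fst X Y).hom.hom.hom 2 (complexBetti.map eX.ι 2 (g eX.n)) +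
            complexBetti.map (AbelianVariety.snd X Y).hom.hom.hom 2 (complexBetti.map eY.ι 2 (g eY.n))) ∧
      (∀ (X : AbelianVariety ℂ) (eX : ProjectiveEmbedding X.X) (m : ℕ), 0 < m →
        ∃ e : ProjectiveEmbedding X.X,
          complexBetti.map e.ι 2 (g e.n) = (m : ℂ) • complexBetti.map eX.ι 2 (g eX.n)) := by
  let ψ : ∀ N : ℕ, ComplexPoints (projectiveSpace N ℂ) ≃ₜ ℙ ℂ (Fin (N + 1) → ℂ) := fun N =>
    (isHomeomorph_projPoint N).homeomorph.symm
  have hψ : ∀ (N : ℕ) (z : Fin (N + 1) → ℂ) (hz : z ≠ 0),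
      (ψ N).symm (Projectivization.mk ℂ z hz) = ProjectiveSpace.pointOfVec ℂ z hz := fun N z hz => by
    change projPoint N (Projectivization.mk ℂ z hz) = _
    rw [projPoint_mk, pointOfVec_eq]
  let G : ∀ N : ℕ, singularCohomology ℚ ℚ (ComplexPoints (projectiveSpace N ℂ)) 2 := fun N =>
    singularCohomology.map ℚ ℚ (ψ N : C(ComplexPoints (projectiveSpace N ℂ), ℙ ℂ (Fin (N + 1) → ℂ))) 2
      (tautEuler (Fin (N + 1) → ℂ) ℚ 1)
  have hG : ∀ N, G N = singularCohomology.map ℚ ℚ (ψ N : C(ComplexPoints (projectiveSpace N ℂ), ℙ ℂ (Fin (N + 1) → ℂ))) 2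
      (tautEuler (Fin (N + 1) → ℂ) ℚ 1) := fun N => rfl
  refine ⟨fun N => singularCohomology.ringChange (algebraMap ℚ ℂ) (ComplexPoints (projectiveSpace N ℂ)) 2 (G N),
    fun N => isRationalClass_ringChange _, g_ne_zero hG (fun N => rfl),
    fun X e h => h.trans (le_of_isClosedImmersion_projectiveSpace (X.isSmoothProjective_of_isProjectiveOver e.isProjectiveOver) e.ι),
    fun X Y eX eY => ⟨⟨eX.n * eY.n + eX.n + eY.n, (eX.ι ⊗ₘ eY.ι) ≫ segreEmbedding eX.n eY.n ℂ,
      isClosedImmersion_tensorHom_segre eX.ι eY.ι⟩, map_tensorHom_segre hψ hG (fun N => rfl) eX.ι eY.ι⟩,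
    fun X eX => exists_weight hψ hG (fun N => rfl) X eX⟩

end Summit.HodgeConjecture.HodgeConjecture.Theorems.WeilSixfoldsSqrtMinus7.HyperbolicEightfoldDescent

end
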